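import Literature.AnabelianGeometry.AbsoluteAnabelian.GaloisCyclotome
import Literature.NumberTheory.GaloisRepresentations.LocalWeilDatumNorm
import Literature.NumberTheory.GaloisRepresentations.LocalWeilDatumExtensionGalois
import Literature.GroupTheory.Transfer.TransferDenseImage
import HarnessLib

/-!
# The Verlagerung `Gal(F̄/E)^ab → Gal(F̄/E')^ab` read on Weil-group representatives

Topic `AnabelianGeometry/AbsoluteAnabelian`; namespace
`Literature.AnabelianGeometry.AbsoluteAnabelian`.  Proof-only.  For a non-archimedean local field `F`
and finite `E ≤ E' ⊆ F̄`, the Verlagerung of `GaloisCyclotome.lean` between the open subgroups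
`Gal(F̄/E') ≤ Gal(F̄/E)` of `Γ_F` ([AbsTopIII] Cor. 1.10 (i) "the Verlagerung, or transfer, map"),
evaluated on the class of a Weil element `τ ∈ W_F ∩ G_E`, is the orbit product
`∏_q [g_q⁻¹ τ^{f_q} g_q]` over the orbits of `⟨τ⟩` on `(W_F ∩ G_E)/(W_F ∩ G_{E'})` with Weil
representatives `g_q` (Serre VII §8 Prop. 8 along the coset-dense `W_F ∩ G_E → Gal(F̄/E)`,
`TransferDenseImage.lean`; density of `W_F`: `exists_toAbsGalois_mem_smul_galFixing`) — the indexing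
of Neukirch's Prop. IV (5.9) for the local Weil datum (`LocalReciprocityTransferFinite.lean`).

* `verlagerung_toAbsGalois_eq_finprod`.
-/

noncomputable section

open Field IsNonarchimedeanLocalField ValuativeRel
open scoped Pointwise

namespace Literature.AnabelianGeometry.AbsoluteAnabelian

open Literature.NumberTheory.GaloisRepresentations
open Literature.NumberTheory.GaloisRepresentations.LocalWeilDatum
open Literature.GroupTheory.Transfer

variable (F : Type*) [Field F] [ValuativeRel F] [TopologicalSpace F] [IsNonarchimedeanLocalField F]
  {E E' : IntermediateField F (AlgebraicClosure F)}

/-- `W_F ∩ G_E → Gal(F̄/E)` meets every coset of `Gal(F̄/E')` (`W_F` is dense in `Γ_F`).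
[cite: TateCorvallis1979, (1.4.1)] -/
private theorem forall_exists_weil [FiniteDimensional F E'] (h : E ≤ E')
    (γ : galFixing F E) :
    ∃ k : fieldSubgroup F E,
      (toGalFixing F E k)⁻¹ * γ ∈ (galFixing F E').subgroupOf (galFixing F E) := by
  obtain ⟨w, hw⟩ := exists_toAbsGalois_mem_smul_galFixing F E' (γ : absoluteGaloisGroup F)
  obtain ⟨k, hk, hwk⟩ := Set.mem_smul_set.mp hw
  rw [smul_eq_mul] at hwk
  have hwE : w ∈ fieldSubgroup F E := by
    rw [← toAbsGalois_mem_galFixing_iff, ← hwk]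
    exact (galFixing F E).mul_mem γ.2 (galFixing_antitone F h hk)
  refine ⟨⟨w, hwE⟩, ?_⟩
  rw [Subgroup.mem_subgroupOf, Subgroup.coe_mul, Subgroup.coe_inv]
  change (WeilGroup.toAbsGalois F w)⁻¹ * (γ : absoluteGaloisGroup F) ∈ galFixing F E'
  rw [← hwk, mul_inv_rev, mul_assoc, inv_mul_cancel, mul_one]
  exact (galFixing F E').inv_mem hk

/-- **The Verlagerung on Weil representatives**: for finite `E ≤ E' ⊆ F̄`, `τ ∈ W_F ∩ G_E`, and
representatives `g_q ∈ W_F ∩ G_E` of the orbits `q` of `⟨τ⟩` on `(W_F ∩ G_E)/(W_F ∩ G_{E'})` with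
orbit lengths `f_q`: `Ver([τ]) = ∏_q [g_q⁻¹ τ^{f_q} g_q]` in `Gal(F̄/E')^{ab}`.
[cite: MochizukiAbsTopIII2015, Cor 1.10 (i) p.42] -/
theorem verlagerung_toAbsGalois_eq_finprod [FiniteDimensional F E] [FiniteDimensional F E']
    (h : E ≤ E') {τ : WeilGroup F} (hτ : τ ∈ fieldSubgroup F E)
    (g : MulAction.orbitRel.Quotient (Subgroup.zpowers (⟨τ, hτ⟩ : fieldSubgroup F E))
      (fieldSubgroup F E ⧸ (fieldSubgroup F E').subgroupOf (fieldSubgroup F E)) → fieldSubgroup F E)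
    (hg : ∀ q, Quotient.mk _ ((g q : fieldSubgroup F E) :
      fieldSubgroup F E ⧸ (fieldSubgroup F E').subgroupOf (fieldSubgroup F E)) = q) :
    haveI : CompactSpace (absoluteGaloisGroup F) := absoluteGaloisGroup_compactSpace F
    verlagerung (isOpen_galFixing F E) (isOpen_galFixing F E') (galFixing_antitone F h)
        (QuotientGroup.mk (⟨WeilGroup.toAbsGalois F τ, (toAbsGalois_mem_galFixing_iff F).mpr hτ⟩ :
          galFixing F E)) =
      ∏ᶠ q, (QuotientGroup.mk (⟨WeilGroup.toAbsGalois F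
          ((((g q : fieldSubgroup F E) : WeilGroup F))⁻¹ *
            τ ^ Function.minimalPeriod ((⟨τ, hτ⟩ : fieldSubgroup F E) • ·)
              ((g q : fieldSubgroup F E) :
                fieldSubgroup F E ⧸ (fieldSubgroup F E').subgroupOf (fieldSubgroup F E)) *
            (g q : fieldSubgroup F E)),
          (toAbsGalois_mem_galFixing_iff F).mpr (Subgroup.mem_subgroupOf.mp
            (inv_mul_pow_minimalPeriod_mul_mem ((fieldSubgroup F E').subgroupOf (fieldSubgroup F E))
              (⟨τ, hτ⟩ : fieldSubgroup F E) (g q)))⟩ :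
          galFixing F E') : TopologicalAbelianization (galFixing F E')) := by
  haveI : CompactSpace (absoluteGaloisGroup F) := absoluteGaloisGroup_compactSpace F
  haveI : ((galFixing F E').subgroupOf (galFixing F E)).FiniteIndex :=
    finiteIndex_subgroupOf (isOpen_galFixing F E) (isOpen_galFixing F E')
  rw [verlagerung_mk]
  unfold transferToAbelianization
  -- the subgroup of `W_F ∩ G_E` pulled back from `Gal(F̄/E') ≤ Gal(F̄/E)` is `W_F ∩ G_{E'}`
  have hcomap : ((galFixing F E').subgroupOf (galFixing F E)).comap (toGalFixing F E) =
      (fieldSubgroup F E').subgroupOf (fieldSubgroup F E) := rfl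
  have key := transfer_apply_eq_finprod_of_forall_exists (toGalFixing F E)
    (forall_exists_weil F h) (toAbelianizationOfLe (galFixing_antitone F h)) ⟨τ, hτ⟩ g hg
  exact key

end Literature.AnabelianGeometry.AbsoluteAnabelian
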